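import Literature.AlgebraicGeometry.Surfaces.PolarisedK3TwinKuranishiFamily
import Literature.AlgebraicGeometry.Surfaces.K3PeriodSurjectivityProofs
import Literature.AlgebraicGeometry.Surfaces.K3TwistorLines
import Literature.AlgebraicGeometry.Surfaces.K3TwoZeroLine
import Literature.AlgebraicGeometry.Surfaces.MarkedComplexK3
import Literature.AlgebraicGeometry.HodgeTheory.HodgeStructureOfHodgeModel
import Literature.AlgebraicGeometry.Motives.HodgeDecompositionIsInternalDischarge
import Literature.AlgebraicGeometry.Motives.GAGAKaehlerImmersionProofs

/-!
# Route NikulinTwinTransport · crux `K3PeriodSurjective` (stmt-HodgeConjecture-15154) —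
# stub `stub_realised_locallySurjective` of line `IdeatorOneSketch` (card `ratner-orbit-closure-cm-seed`)

T2b, LOCAL SURJECTIVITY OF THE PROJECTIVE PERIOD MAP AT A REALISED PERIOD: if `y ∈ D` is the period
vector of a marked algebraic K3 surface, then every projective period vector `z` (`z ∈ D`, some
integral `v ⊥ z` with `v² > 0`) in a neighbourhood of `y` is the period vector of a marked algebraic
K3 surface. Printed proof (Huybrechts, *Lectures on K3 Surfaces*): pass to the complex K3 surface
`S^an`, deform it in its Kuranishi family — local Torelli, Ch. 6 Cor. 2.7 / Prop. 2.8 — and come back: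
a small deformation with an integral `(1,1)`-class of positive square is projective (Ch. 1 §3.3 =
BHPV IV.6.2) and therefore the analytification of an algebraic K3 surface (GAGA, Ch. 1 Prop. 3.2).

PROVED here (conditional on the two named facts of `Literature/AlgebraicGeometry/Surfaces/MarkedComplexK3`,
`Huybrechts_K3_localTorelli_markedComplex` and `Huybrechts_K3_isAnalytification_of_markedComplex_projective`):
* `exists_isMarkedComplexK3_of_isMarkedK3` — an algebraic marked K3 surface `(S, φ, p, y)`, `y ≠ 0`,
  gives a marked COMPLEX K3 surface on any Hodge model `A` of `S` carrying the holomorphic `2`-form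
  `η` of `IsK3Surface` (comparison `A.deRham`, marking pulled back along `A^an → S(ℂ)`, `η` rescaled:
  the `(2,0)`-class `φ⁻¹ y` reads in `A` as `s[η]`, `s ≠ 0`, by `hodgePQ_independent_of_hodgeModel_holds`
  and `h^{2,0} ≤ 1`, `TwoForms.exists_eq_const_smul`);
* `isMarkedK3_of_isMarkedComplexK3` — conversely a marked complex K3 surface with a projective period
  vector `x ≠ 0` is a marked ALGEBRAIC K3 surface: the second fact makes `M` the analytification of a
  smooth projective `S` with `H¹(𝒪) = 0`; `M` with the given natural comparison is a Hodge model of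
  `S` (`isKaehlerManifold_of_isAnalytification_of_isClosedImmersion_holds`, `isInternal_hodgePQ_holds`),
  `η` witnesses `IsK3Surface S`, the marking descends (integral classes and cup product along the
  comparison homeomorphism), `φ⁻¹ x = e[η]` is of type `(2,0)` and spans by `IsK3Surface.twoZero_line`;
* `stub_realised_locallySurjective_of` — the registered stub, from the two facts and the two bridges.
-/

noncomputable section

set_option linter.dupNamespace false

open scoped Manifold ContDiff Topology Matrix
open CategoryTheory
open Literature.AlgebraicTopology.SingularHomology Literature.AlgebraicGeometry.HodgeTheory
  Literature.Geometry.Kaehler Literature.NumberTheory.Transcendental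

/-! ## Transport of markings between an algebraic K3 surface and its Hodge model -/

namespace Summit.HodgeConjecture.HodgeConjecture.Theorems.NikulinTwinTransport

open Literature.AlgebraicGeometry Literature.AlgebraicGeometry.Surfaces

/-! ### Integral classes along homeomorphisms -/

/-- Integral classes correspond under a homeomorphism (pull back along `h` and along `h⁻¹`). -/
theorem isIntegralClass_map_homeomorph_iff {Y Y' : Type} [TopologicalSpace Y] [TopologicalSpace Y']
    (h : Y ≃ₜ Y') {k : ℕ} (c : singularCohomology ℂ ℂ Y' k) :
    IsIntegralClass (singularCohomology.map ℂ ℂ ⟨h, h.continuous⟩ k c) ↔ IsIntegralClass c := by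
  refine ⟨fun hc => ?_, fun hc => hc.map _⟩
  have h1 := hc.map ⟨h.symm, h.symm.continuous⟩
  have h2 : singularCohomology.map ℂ ℂ ⟨h.symm, h.symm.continuous⟩ k
      (singularCohomology.map ℂ ℂ ⟨h, h.continuous⟩ k c) = c := by
    rw [← ModuleCat.comp_apply, ← singularCohomology.map_comp]
    have hid : (ContinuousMap.mk h h.continuous).comp ⟨h.symm, h.symm.continuous⟩ =
        ContinuousMap.id Y' := by
      ext y
      exact h.apply_symm_apply y
    rw [hid, singularCohomology.map_id]
    rfl
  rwa [h2] at h1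

/-! ### From an algebraic marked K3 surface to a marked complex K3 surface (its Hodge model) -/

section Bridge

variable {S : Motives.SchemeOver ℂ}

/-- In a Hodge model `A` of a K3 surface carrying the nowhere-vanishing holomorphic `2`-form `η`,
every de Rham class of type `(2,0)` is a multiple of `[η]` (`h^{2,0} ≤ 1`,
`TwoForms.exists_eq_const_smul`). -/
theorem hodgePQ_twoZero_le_span (hS : IsK3Surface S) (A : HodgeModel 2 S)
    {η : MForm 𝓘(ℝ, A.model) A.carrier ℂ 2} (hη : IsHolomorphicInCharts η) (hη0 : ∀ m, η m ≠ 0)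
    (hηZ : η ∈ cclosedSmoothForms A.model A.carrier (2 * 1))
    (y : complexDeRhamCohomology A.model A.carrier (2 * 1))
    (hy : y ∈ hodgePQ A.model A.carrier (2 * 1) 2 0) :
    ∃ t : ℂ, y = t • complexDeRhamCohomology.mk A.model A.carrier (2 * 1) ⟨η, hηZ⟩ := by
  have hX := hS.isSmoothProjective
  haveI : CompactSpace A.carrier := by
    haveI : CompactSpace (Motives.ComplexPoints S) :=
      Motives.ComplexPoints.compactSpace_of_isSmoothProjective hX
    exact A.isAnalytification.homeomorph.symm.compactSpace
  haveI : ConnectedSpace A.carrier := A.connectedSpace_carrier hX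
  have h2 : Module.finrank ℂ A.model = 2 := A.isAnalytification.finrank_eq
  induction hy using Submodule.span_induction with
  | mem y hy =>
    obtain ⟨β, hβt, rfl⟩ := hy
    obtain ⟨hβs, hβc⟩ :=
      (mem_cclosedSmoothForms_iff (β : MForm 𝓘(ℝ, A.model) A.carrier ℂ (2 * 1))).1 β.2
    obtain ⟨t, ht⟩ := TwoForms.exists_eq_const_smul h2 hη hη0 hβs hβc hβt
    refine ⟨t, ?_⟩
    rw [← map_smul]
    congr 1
    exact Subtype.ext ht
  | zero => exact ⟨0, by rw [zero_smul]⟩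
  | add y z _ _ hy hz =>
    obtain ⟨s, rfl⟩ := hy
    obtain ⟨t, rfl⟩ := hz
    exact ⟨s + t, by rw [add_smul]⟩
  | smul a y _ hy =>
    obtain ⟨t, rfl⟩ := hy
    exact ⟨a * t, by rw [mul_smul]⟩

/-- Integral classes of `X(ℂ)` and of a Hodge model correspond under the pull-back. -/
theorem isIntegralClass_pullback_iff {n : ℕ} {X : Motives.SchemeOver ℂ} (A : HodgeModel n X)
    {k : ℕ} (c : complexBetti X k) : IsIntegralClass (A.pullback k c) ↔ IsIntegralClass c :=
  isIntegralClass_map_homeomorph_iff A.isAnalytification.homeomorph c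

/-- **An algebraic marked K3 surface is a marked complex K3 surface** — on any Hodge model `A` of
`S` carrying the nowhere-vanishing holomorphic `2`-form `η` of `IsK3Surface`, with the comparison
`A.deRham`, the pulled-back marking and a rescaled `η`: the `(2,0)`-class `φ⁻¹(y)` reads in `A` as
a non-zero multiple `s[η]` (`hodgePQ_independent_of_hodgeModel_holds`, `h^{2,0} ≤ 1`), and
`[s η] = s [η]`. Requires `y ≠ 0`. -/
theorem exists_isMarkedComplexK3_of_isMarkedK3 (hS : IsK3Surface S)
    {φS : complexBetti S (2 * 1) ≃ₗ[ℂ] (K3Index → ℂ)} {pS : complexBetti S (2 * 2)}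
    {y : K3Index → ℂ} (hM : IsMarkedK3 S φS pS y) (hy0 : y ≠ 0) :
    ∃ (E : Type) (_ : NormedAddCommGroup E) (_ : NormedSpace ℂ E) (_ : FiniteDimensional ℂ E)
      (e : ComplexDeRhamIsoFamily E) (_ : e.IsNatural)
      (M : Type) (_ : TopologicalSpace M) (_ : ChartedSpace E M) (_ : IsManifold 𝓘(ℂ, E) ω M)
      (_ : IsManifold 𝓘(ℝ, E) ∞ M) (_ : T2Space M) (_ : CompactSpace M)
      (η : MForm 𝓘(ℝ, E) M ℂ 2) (φ : singularCohomology ℂ ℂ M (2 * 1) ≃ₗ[ℂ] (K3Index → ℂ))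
      (p : singularCohomology ℂ ℂ M (2 * 2)), IsMarkedComplexK3 e M η φ p y := by
  have hX := hS.isSmoothProjective
  obtain ⟨A, η, hη, hη0⟩ := hS.exists_holomorphicTwoForm_ne_zero
  haveI : CompactSpace A.carrier := by
    haveI : CompactSpace (Motives.ComplexPoints S) :=
      Motives.ComplexPoints.compactSpace_of_isSmoothProjective hX
    exact A.isAnalytification.homeomorph.symm.compactSpace
  haveI : ConnectedSpace A.carrier := A.connectedSpace_carrier hX
  have h2 : Module.finrank ℂ A.model = 2 := A.isAnalytification.finrank_eq
  have hηZ : η ∈ cclosedSmoothForms A.model A.carrier (2 * 1) := hη.mem_cclosedSmoothForms h2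
  obtain ⟨hp, hgen, hint, hcup, htype, -⟩ := hM
  -- the `(2,0)`-class `φS⁻¹ y` read in the model `A` is a non-zero multiple `s [η]`
  have hI := hodgePQ_independent_of_hodgeModel_holds
  obtain ⟨yσ, hyσ, hyσe⟩ := (hI.isOfHodgeType_iff hX A).1 htype
  obtain ⟨s, rfl⟩ := hodgePQ_twoZero_le_span hS A hη hη0 hηZ yσ hyσ
  have hs0 : s ≠ 0 := by
    rintro rfl
    apply hy0
    have h0 : A.pullback (2 * 1) (φS.symm y) = 0 := by
      rw [← hyσe, zero_smul, map_zero]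
    have h1 : φS.symm y = 0 := A.pullback_injective (2 * 1) (by rw [h0, map_zero])
    simpa using congrArg φS h1
  have hsZ : s • η ∈ cclosedSmoothForms A.model A.carrier (2 * 1) := Submodule.smul_mem _ s hηZ
  refine ⟨A.model, inferInstance, inferInstance, inferInstance, A.deRham, A.deRham_isNatural,
    A.carrier, inferInstance, inferInstance, inferInstance, inferInstance, inferInstance,
    inferInstance, s • η, (A.pullbackEquiv (2 * 1)).symm.trans φS, A.pullback (2 * 2) pS,
    inferInstance, h2, hη.smul s, fun m => smul_ne_zero hs0 (hη0 m), hp.map _, ?_, ?_, ?_,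
    hsZ, ?_⟩
  · -- integral classes of `H⁴` are multiples of the pulled-back generator
    intro q hq
    obtain ⟨q', rfl⟩ := A.pullback_surjective (2 * 2) q
    obtain ⟨n, rfl⟩ := hgen q' ((isIntegralClass_pullback_iff A q').1 hq)
    exact ⟨n, by rw [map_zsmul]⟩
  · -- integral classes of `H²` are `φ⁻¹(ℤ²²)`
    intro c
    obtain ⟨c', rfl⟩ := A.pullback_surjective (2 * 1) c
    rw [isIntegralClass_pullback_iff A c', hint c', LinearEquiv.trans_apply,
      ← HodgeModel.pullbackEquiv_apply, LinearEquiv.symm_apply_apply]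
  · -- cup product
    intro a b
    obtain ⟨a', rfl⟩ := A.pullback_surjective (2 * 1) a
    obtain ⟨b', rfl⟩ := A.pullback_surjective (2 * 1) b
    rw [← cupProduct_map _ rfl a' b', hcup a' b', map_smul, LinearEquiv.trans_apply,
      LinearEquiv.trans_apply, ← HodgeModel.pullbackEquiv_apply A (2 * 1) a',
      ← HodgeModel.pullbackEquiv_apply A (2 * 1) b', LinearEquiv.symm_apply_apply,
      LinearEquiv.symm_apply_apply]
  · -- the period clause: `φ⁻¹ y = A.pullback (φS⁻¹ y) = e (s [η]) = e [s η]`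
    rw [LinearEquiv.trans_symm, LinearEquiv.trans_apply, LinearEquiv.symm_symm,
      HodgeModel.pullbackEquiv_apply, ← hyσe, ← map_smul]
    rfl

end Bridge

/-! ### From a marked complex K3 surface with a projective period to an algebraic marked K3 -/

section Algebraic

/-- A period vector of the period domain is non-zero (`(x̄.x) > 0`). -/
theorem ne_zero_of_mem_k3PeriodDomain {x : K3Index → ℂ} (hx : x ∈ k3PeriodDomain) : x ≠ 0 := by
  rintro rfl
  have h := hx.2
  simp [k3Form] at h

/-- **A marked complex K3 surface with a projective period vector is a marked ALGEBRAIC K3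
surface** (from the named fact `Huybrechts_K3_isAnalytification_of_markedComplex_projective`):
the fact makes `M` the analytification of a smooth projective surface `S` with `H¹(𝒪) = 0`; `M`
with the given natural comparison `e` is then a Hodge model of `S` (Kähler:
`isKaehlerManifold_of_isAnalytification_of_isClosedImmersion_holds`; Hodge decomposition:
`isInternal_hodgePQ_holds`), on which `η` witnesses `IsK3Surface S`; the marking is pushed down
along the comparison homeomorphism (integral classes, cup product by naturality), `φ⁻¹(x) = e[η]`
is of type `(2,0)` in this model, and spans the `(2,0)`-classes by `h^{2,0} ≤ 1`
(`IsK3Surface.twoZero_line`). Requires `x ≠ 0`. -/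
theorem isMarkedK3_of_isMarkedComplexK3
    (hPA : Huybrechts_K3_isAnalytification_of_markedComplex_projective)
    {E : Type} [NormedAddCommGroup E] [NormedSpace ℂ E] [FiniteDimensional ℂ E]
    {e : ComplexDeRhamIsoFamily E} (he : e.IsNatural)
    {M : Type} [TopologicalSpace M] [ChartedSpace E M] [IsManifold 𝓘(ℂ, E) ω M]
    [IsManifold 𝓘(ℝ, E) ∞ M] [T2Space M] [CompactSpace M] {η : MForm 𝓘(ℝ, E) M ℂ 2}
    {φ : singularCohomology ℂ ℂ M (2 * 1) ≃ₗ[ℂ] (K3Index → ℂ)}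
    {p : singularCohomology ℂ ℂ M (2 * 2)} {x : K3Index → ℂ}
    (hM : IsMarkedComplexK3 e M η φ p x) (hx0 : x ≠ 0)
    (hv : ∃ v : K3Index → ℤ, k3Form (fun i => (v i : ℂ)) x = 0 ∧
      0 < ∑ i, ∑ j, v i * k3Gram i j * v j) :
    ∃ (S : Motives.SchemeOver ℂ) (_ : IsK3Surface S)
      (φ' : complexBetti S (2 * 1) ≃ₗ[ℂ] (K3Index → ℂ)) (p' : complexBetti S (2 * 2)),
      IsMarkedK3 S φ' p' x := by
  obtain ⟨S, ψ, hX, hH1, hψ⟩ := hPA E e he M η φ p x hM hv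
  obtain ⟨_, h2, hη, hη0, hp, hgen, hint, hcup, hηZ, hper⟩ := hM
  -- `M` with `e` is a Hodge model of `S`
  haveI : AlgebraicGeometry.SmoothOfRelativeDimension 2 S.hom := hX.smoothOfRelativeDimension
  obtain ⟨N, ι, hι⟩ := hX.isProjectiveOver
  haveI : IsKaehlerManifold E M :=
    Motives.isKaehlerManifold_of_isAnalytification_of_isClosedImmersion_holds ι hψ
  let A : HodgeModel 2 S :=
    { model := E
      carrier := M
      toComplexPoints := ψ
      isAnalytification := hψ
      deRham := e
      deRham_isNatural := he
      isInternal_hodgePQ := fun k ↦ Motives.isInternal_hodgePQ_holds (E := E) (M := M) k }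
  have hS : IsK3Surface S := ⟨hX, hH1, A, η, hη, hη0⟩
  -- the pushed-down marking
  let φ' : complexBetti S (2 * 1) ≃ₗ[ℂ] (K3Index → ℂ) := (A.pullbackEquiv (2 * 1)).trans φ
  let p' : complexBetti S (2 * 2) := (A.pullbackEquiv (2 * 2)).symm p
  have hpp : A.pullback (2 * 2) p' = p := by
    rw [← HodgeModel.pullbackEquiv_apply]
    exact LinearEquiv.apply_symm_apply _ _
  have hφ' : ∀ c, φ' c = φ (A.pullback (2 * 1) c) := fun c => rfl
  have hxx : A.pullback (2 * 1) (φ'.symm x) = φ.symm x := by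
    rw [← HodgeModel.pullbackEquiv_apply]
    exact LinearEquiv.apply_symm_apply _ _
  -- `φ'⁻¹ x` is of type `(2,0)`, read in the model `A`
  have h20 : IsOfHodgeType 2 S (2 * 1) 2 0 (φ'.symm x) := by
    refine ⟨A, ?_⟩
    rw [hxx, hper]
    exact Submodule.mem_map_of_mem
      (Submodule.subset_span ⟨⟨η, hηZ⟩, (hη.isOfType : IsOfType 2 0 η), rfl⟩)
  have hne : φ'.symm x ≠ 0 := by
    intro h0
    apply hx0
    simpa using congrArg φ' h0
  refine ⟨S, hS, φ', p', ?_, ?_, ?_, ?_, h20, fun σ hσ => hS.twoZero_line h20 hne σ hσ⟩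
  · rw [← isIntegralClass_pullback_iff A p', hpp]
    exact hp
  · intro q hq
    obtain ⟨n, hn⟩ := hgen _ ((isIntegralClass_pullback_iff A q).2 hq)
    refine ⟨n, A.pullback_injective (2 * 2) ?_⟩
    rw [hn, map_zsmul, hpp]
  · intro c
    rw [← isIntegralClass_pullback_iff A c, hint, hφ']
  · intro a b
    apply A.pullback_injective (2 * 2)
    rw [cupProduct_map _ rfl a b, hcup, map_smul, hpp, hφ', hφ']

end Algebraic

/-! ### The stub: local surjectivity of the projective period map at a realised period -/

/-- **T2b · local surjectivity at a realised period** — the registered stub of line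
`IdeatorOneSketch` of crux `K3PeriodSurjective`, CONDITIONAL on the two named facts
`Huybrechts_K3_localTorelli_markedComplex` (local Torelli, image form) and
`Huybrechts_K3_isAnalytification_of_markedComplex_projective` (projectivity criterion + GAGA):
pass to the Hodge model (`exists_isMarkedComplexK3_of_isMarkedK3`), deform (local Torelli), and
come back (`isMarkedK3_of_isMarkedComplexK3`). -/
theorem stub_realised_locallySurjective_of (hLT : Huybrechts_K3_localTorelli_markedComplex)
    (hPA : Huybrechts_K3_isAnalytification_of_markedComplex_projective) : ∀ y : K3Index → ℂ, y ∈ k3PeriodDomain → (∃ (S : Motives.SchemeOver ℂ) (_ : IsK3Surface S) (φ : complexBetti S (2 * 1) ≃ₗ[ℂ] (K3Index → ℂ)) (p : complexBetti S (2 * 2)), IsMarkedK3 S φ p y) → ∃ W ∈ 𝓝 y, ∀ z ∈ W, z ∈ k3PeriodDomain → (∃ v : K3Index → ℤ, k3Form (fun i => (v i : ℂ)) z = 0 ∧ 0 < ∑ i, ∑ j, v i * k3Gram i j * v j) → ∃ (S : Motives.SchemeOver ℂ) (_ : IsK3Surface S) (φ : complexBetti S (2 * 1) ≃ₗ[ℂ]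 (K3Index → ℂ)) (p : complexBetti S (2 * 2)), IsMarkedK3 S φ p z := by
  rintro y hyD ⟨S, hS, φS, pS, hM⟩
  obtain ⟨E, _, _, _, e, he, M, _, _, _, _, _, _, η, φ, p, hMc⟩ :=
    exists_isMarkedComplexK3_of_isMarkedK3 hS hM (ne_zero_of_mem_k3PeriodDomain hyD)
  obtain ⟨W, hW, hloc⟩ := hLT E e he M η φ p y hMc
  refine ⟨W, hW, fun z hz hzD hv => ?_⟩
  obtain ⟨M', _, _, _, _, _, _, η', φ', p', hM'⟩ := hloc z hz hzD
  exact isMarkedK3_of_isMarkedComplexK3 hPA he hM' (ne_zero_of_mem_k3PeriodDomain hzD) hv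

end Summit.HodgeConjecture.HodgeConjecture.Theorems.NikulinTwinTransport

end
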